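import Mathlib.NumberTheory.LegendreSymbol.Basic
import Mathlib.Analysis.Complex.Basic
import Mathlib.Algebra.Polynomial.Basic

/-!
# Route FeketeSOS — crux `FeketeSOSHard` (stmt-ValiantsHypothesis-3996), line `paley-rip`: the line's objects

Definitions file for the registered line `Cruxes/FeketeSOSHard/Lines/paley_rip.lean` (crux-strategist,
skeleton of record of stmt-ValiantsHypothesis-3996; stubs `stub_paleyMassIdentity` [provable],
`stub_paleyFlatRIP` [engine, conjecture-class], `stub_tameReduction` [open], `stub_paleyCompletionBound`
[provable]). The line states its stubs over three small objects which it defines locally; this file puts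
them, VERBATIM and under the same names and namespace, into an importable module so that the provable
stubs can be landed with their registered signatures (separate theorem files):

* `fek p` — the Fekete polynomial over `ℂ` exactly as inlined in the crux, `Σ_{m<p} (m|p) X^m`;
* `paleyForm p S w` — the (cyclic) Paley–Hankel quadratic form `Q_p(S,w) = Σ_{a,b∈S} χ_p(a+b) w_a w_b`
  (`χ_p` = Legendre symbol, `p`-periodic);
* `sqMass c g` — the archimedean mass `|c| · Σ_{a∈supp g} |g_a|²` of one weighted square `c · g²`.

No statement is asserted here. Honest framing: vocabulary only; the crux `FeketeSOSHard` is OPEN and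
nothing here bears on `VP ≠ VNP`.

References: A. S. Bandeira, D. G. Mixon, J. Moreira, *A conditional construction of restricted isometries*,
IMRN 2017 (arXiv:1410.6457), Def. 2.1 (Paley matrix / restricted isometries); the line card
`Cruxes/FeketeSOSHard/Lines/paley-rip.md`.
-/

set_option linter.dupNamespace false

namespace Summit.ValiantsHypothesis.ValiantsHypothesis.Theorems.FeketeSOSHardPaleyRIP

open Polynomial Finset

noncomputable section

/-- The Fekete polynomial over `ℂ` exactly as inlined in the crux `FeketeSOS.FeketeSOSHard`:
`F_p = Σ_{m<p} (m|p) X^m` (Legendre symbols as complex coefficients). [folklore] -/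
def fek (p : ℕ) [Fact p.Prime] : ℂ[X] :=
  ∑ m ∈ range p, C ((legendreSym p m : ℤ) : ℂ) * X ^ m

/-- The Paley–Hankel quadratic form of a coefficient vector `w` on a finite set `S ⊆ ℕ`:
`Q_p(S, w) = Σ_{a,b ∈ S} χ_p(a+b) · w a · w b` (the Legendre symbol is `p`-periodic, so this is the
CYCLIC Paley–Hankel form; Bandeira–Mixon–Moreira's Paley matrix under `b ↦ −b`). [folklore] -/
def paleyForm (p : ℕ) [Fact p.Prime] (S : Finset ℕ) (w : ℕ → ℂ) : ℂ :=
  ∑ a ∈ S, ∑ b ∈ S, ((legendreSym p ((a : ℤ) + b) : ℤ) : ℂ) * w a * w b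

/-- The archimedean mass of one weighted square `c · g²`: `|c| · Σ_{a ∈ supp g} |g_a|²`. [folklore] -/
def sqMass (c : ℂ) (g : ℂ[X]) : ℝ :=
  ‖c‖ * ∑ a ∈ g.support, ‖g.coeff a‖ ^ 2

end

end Summit.ValiantsHypothesis.ValiantsHypothesis.Theorems.FeketeSOSHardPaleyRIP
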